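import Literature.AnabelianGeometry.SemiGraphs.PSCTwoComponentPointedIncidence
import Literature.AnabelianGeometry.SemiGraphs.PSCTwoComponentPointedProp12
import Literature.AnabelianGeometry.SemiGraphs.PSCTwoComponentAffinePointedOrigin
import Literature.AnabelianGeometry.SemiGraphs.PSCGraphicConverseIncidence
import HarnessLib

/-!
# [CombGC] Prop. 1.2, Prop. 1.5, Thm. 1.6 (i) at the origin of ALL two-component one-node curves with both components marked

Mochizuki, *A combinatorial version of the Grothendieck conjecture*, Tohoku Math. J. **59** (2007)
[CombGC] §1: Prop. 1.2 (i)(ii) p. 8, Prop. 1.5 (i)(ii) pp. 12–13, Thm. 1.6 (i) p. 13; [IUTchI] Rmk. 1.2.3 (iv)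
(cuspidal edge-like characterization) [cite: MochizukiCombGC2007, Prop 1.5(ii) p.13]
[cite: MochizukiCombGC2007, Prop 1.5(i) p.12] [cite: MochizukiCombGC2007, Prop 1.2 pp.8-9]
[cite: MochizukiCombGC2007, Thm 1.6(i) p.13].  abc-iut FACT-LIST rows F-0438, F-0459, F-0440, F-0443, F-1931,
F-0458 (schemata over `Ω : PSCOrigin`; universal closures refuted, instance forms the content).

PROOF-ONLY assembly file (abc-iut-f-164 gen 4).  The origin of TWO-COMPONENT DATA POINTED ON BOTH SIDES
(gen 2, `PSCTwoComponentAffinePointedOrigin.lean`: a pointed stable curve `C₀ ∪_ν C₁`, genera `g₀`, `g − g₀`,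
`1 ≤ s ≤ r − 1` marked points on `C₁` — so EITHER component may carry a SINGLE marked point —, stability
`1 ≤ g₀ ∨ 2 ≤ r − s`, `1 ≤ g − g₀ ∨ 2 ≤ s`; here with `nodeEnds` recorded) strictly contains gen 3's affine
origin (`s ≥ 2`, `r − s ≥ 2`).  Gen 2 had F-0459 / F-1931 / F-0458 there; this gen adds F-0438 (both clauses,
`PSCTwoComponentPointedProp12`), F-0440 (`PSCTwoComponentPointedIncidence`: the lone cusps by Heisenberg
quotients) and hence F-0443 by abc-iut-w4-d081's reduction `graphicIffEdgeLikeVerticialHolds_of_incidence`.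

* `twoComponentPointedOrigin_allRows` — at every such origin (universe `0`): F-0459 ∧ F-0440 ∧ F-0443 ∧
  F-0438 ∧ F-1931 ∧ (for `Σ = {l}`) F-0458;
* `exists_twoComponentPointedOrigin_holds_all` — capstone: the origin of ALL two-component one-node data with
  both components marked and `Σ = {l}` — inhabited for EVERY `g₀ ≤ g`, `1 ≤ s ≤ r − 1` satisfying the
  stability conditions (e.g. a genus-`g₁` component with ONE marked point glued to any pointed `C₀`) —
  satisfies all six rows.  F-0461 is not treated (non-vacuous at sturdy data).

Instance forms at data of the shape of genuine two-component curves: consistency evidence for the typed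
schemata, not the printed theorems for all pointed stable curves (cell FOUNDATIONS rows 13–14).  0
definitions; nothing here takes a side on [IUTchIII] Cor. 3.12.
-/

noncomputable section

namespace Literature.AnabelianGeometry.SemiGraphs

open scoped Pointwise
open Literature.GroupTheory.CombinatorialGroupTheory
open SemiGraphOfAnabelioids (IsProSigmaCompletion)

namespace PSCDatum

/-- **All six rows at every origin of two-component data pointed on both sides** (`nodeEnds` recorded;
profinite `Π` in `Type`; the origin hypothesis in the style of gen 3's `twoComponentAffineOrigin_rows`):
F-0459 (gen 2), F-0440, F-0443, F-0438 (both clauses), F-1931, and F-0458 for `Σ = {l}`.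
[cite: MochizukiCombGC2007, Prop 1.5(ii) p.13] [cite: MochizukiCombGC2007, Prop 1.2 pp.8-9] -/
theorem twoComponentPointedOrigin_allRows (Ω : PSCOrigin.{0})
    (hΩ : ∀ ⦃Q : Type⦄ [Group Q] [TopologicalSpace Q] (G : PSCDatum Q),
      Ω.IsOfPSCType G → ∃ (_ : IsTopologicalGroup Q), CompactSpace Q ∧ T2Space Q ∧
        TotallyDisconnectedSpace Q ∧
        ∃ (S : Set ℕ) (g r g₀ s : ℕ) (ι : PuncturedSurfaceGroup g r →* Q) (e : G.graph.C ≃ Fin r)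
          (v₀ v₁ : G.graph.V) (n₀ : G.graph.N) (ε : PuncturedSurfaceGroup g r),
          S.Nonempty ∧ (∀ p ∈ S, p.Prime) ∧ IsProSigmaCompletion S ι ∧ g₀ ≤ g ∧ 1 ≤ s ∧ s + 1 ≤ r ∧
          (1 ≤ g₀ ∨ 2 ≤ r - s) ∧ (1 ≤ g - g₀ ∨ 2 ≤ s) ∧
          (∀ c, G.cuspGp c =
            ((PuncturedSurfaceGroup.cuspInertia (g := g) (e c)).map ι).topologicalClosure) ∧
          (∀ w, w = v₀ ∨ w = v₁) ∧ (∀ n, n = n₀) ∧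
          ε = ((List.finRange r).map fun j : Fin r =>
            if s ≤ (j : ℕ) then PuncturedSurfaceGroup.c (g := g) j else 1).prod *
          ((List.finRange g).map fun i : Fin g => if (i : ℕ) < g₀ then
            PuncturedSurfaceGroup.a (r := r) i * PuncturedSurfaceGroup.b i *
              (PuncturedSurfaceGroup.a i)⁻¹ * (PuncturedSurfaceGroup.b i)⁻¹ else 1).prod ∧
          G.vertGp v₀ = ((Subgroup.closure {x : PuncturedSurfaceGroup g r |
            (∃ i : Fin g, (i : ℕ) < g₀ ∧ (x = PuncturedSurfaceGroup.a i ∨ x = PuncturedSurfaceGroup.b i)) ∨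
            ∃ j : Fin r, s ≤ (j : ℕ) ∧ x = PuncturedSurfaceGroup.c j}).map ι).topologicalClosure ∧
          G.vertGp v₁ = ((Subgroup.closure {x : PuncturedSurfaceGroup g r |
            (∃ i : Fin g, g₀ ≤ (i : ℕ) ∧ (x = PuncturedSurfaceGroup.a i ∨ x = PuncturedSurfaceGroup.b i)) ∨
            (∃ j : Fin r, (j : ℕ) < s ∧ x = PuncturedSurfaceGroup.c j) ∨ x = ε}).map ι).topologicalClosure ∧
          G.nodeGp n₀ = ((Subgroup.zpowers ε).map ι).topologicalClosure ∧
          G.genus v₀ = g₀ ∧ G.genus v₁ = g - g₀ ∧ (∀ n, G.graph.nodeEnds n = s(v₀, v₁))) :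
    OpenInterDeterminesComponentHolds Ω ∧ EdgeLikeIncidenceHolds Ω ∧ GraphicIffEdgeLikeVerticialHolds Ω ∧
      CommensurableTerminalityHolds Ω ∧ CuspidalEdgeLikeCharacterizationHolds Ω ∧
      ∀ l : ℕ, (∀ ⦃Q : Type⦄ [Group Q] [TopologicalSpace Q] [IsTopologicalGroup Q] (G : PSCDatum Q),
        Ω.IsOfPSCType G → G.Sigma = {l}) → NumericallyCuspidalIffHolds Ω := by
  -- gen 2's origin hypothesis (instance-bound, without `nodeEnds`)
  have hΩ₂ : ∀ ⦃Q : Type⦄ [Group Q] [TopologicalSpace Q] [IsTopologicalGroup Q] (G : PSCDatum Q),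
      Ω.IsOfPSCType G → CompactSpace Q ∧ T2Space Q ∧ TotallyDisconnectedSpace Q ∧
        ∃ (S : Set ℕ) (g r g₀ s : ℕ) (ι : PuncturedSurfaceGroup g r →* Q) (e : G.graph.C ≃ Fin r)
          (v₀ v₁ : G.graph.V) (n₀ : G.graph.N) (ε : PuncturedSurfaceGroup g r),
          S.Nonempty ∧ (∀ p ∈ S, p.Prime) ∧ IsProSigmaCompletion S ι ∧ g₀ ≤ g ∧ 1 ≤ s ∧ s + 1 ≤ r ∧
          (1 ≤ g₀ ∨ 2 ≤ r - s) ∧ (1 ≤ g - g₀ ∨ 2 ≤ s) ∧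
          (∀ c, G.cuspGp c =
            ((PuncturedSurfaceGroup.cuspInertia (g := g) (e c)).map ι).topologicalClosure) ∧
          (∀ w, w = v₀ ∨ w = v₁) ∧ (∀ n, n = n₀) ∧
          ε = ((List.finRange r).map fun j : Fin r =>
            if s ≤ (j : ℕ) then PuncturedSurfaceGroup.c (g := g) j else 1).prod *
          ((List.finRange g).map fun i : Fin g => if (i : ℕ) < g₀ then
            PuncturedSurfaceGroup.a (r := r) i * PuncturedSurfaceGroup.b i *
              (PuncturedSurfaceGroup.a i)⁻¹ * (PuncturedSurfaceGroup.b i)⁻¹ else 1).prod ∧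
          G.vertGp v₀ = ((Subgroup.closure {x : PuncturedSurfaceGroup g r |
            (∃ i : Fin g, (i : ℕ) < g₀ ∧ (x = PuncturedSurfaceGroup.a i ∨ x = PuncturedSurfaceGroup.b i)) ∨
            ∃ j : Fin r, s ≤ (j : ℕ) ∧ x = PuncturedSurfaceGroup.c j}).map ι).topologicalClosure ∧
          G.vertGp v₁ = ((Subgroup.closure {x : PuncturedSurfaceGroup g r |
            (∃ i : Fin g, g₀ ≤ (i : ℕ) ∧ (x = PuncturedSurfaceGroup.a i ∨ x = PuncturedSurfaceGroup.b i)) ∨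
            (∃ j : Fin r, (j : ℕ) < s ∧ x = PuncturedSurfaceGroup.c j) ∨ x = ε}).map ι).topologicalClosure ∧
          G.nodeGp n₀ = ((Subgroup.zpowers ε).map ι).topologicalClosure ∧
          G.genus v₀ = g₀ ∧ G.genus v₁ = g - g₀ := fun Q _ _ _ G hG => by
    obtain ⟨_, hc, ht, hd, S, g, r, g₀, s, ι, e, v₀, v₁, n₀, ε, hne, hprime, hι, hg₀, hs, hsr, hst₀, hst₁, hC,
      hV, hN, hε, hV₀, hV₁, hE, hgen₀, hgen₁, -⟩ := hΩ G hG
    exact ⟨hc, ht, hd, S, g, r, g₀, s, ι, e, v₀, v₁, n₀, ε, hne, hprime, hι, hg₀, hs, hsr, hst₀, hst₁, hC, hV, hN,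
      hε, hV₀, hV₁, hE, hgen₀, hgen₁⟩
  have h12i : OpenInterDeterminesComponentHolds Ω :=
    openInterDeterminesComponentHolds_of_twoComponentAffine' Ω hΩ₂
  have h15i : EdgeLikeIncidenceHolds Ω := by
    intro Q _ _ G hG
    obtain ⟨hTG, hc, ht, hd, S, g, r, g₀, s, ι, e, v₀, v₁, n₀, ε, hne, hprime, hι, hg₀, hs, hsr, hst₀, hst₁, hC,
      hV, hN, hε, hV₀, hV₁, hE, -, -, -⟩ := hΩ G hG
    haveI := hTG
    haveI := hc
    haveI := ht
    haveI := hd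
    exact G.edgeLikeIncidence_of_twoComponentPointed hne hprime ι hι hg₀ hs hsr hst₀ hst₁
      (by unfold PuncturedSurfaceGroup.IsHyperbolicType; omega) e hC v₀ v₁ hV ε hε hV₀ hV₁ n₀ hN hE
  have h15ii : GraphicIffEdgeLikeVerticialHolds Ω :=
    graphicIffEdgeLikeVerticialHolds_of_incidence Ω h12i h15i fun Q _ _ _ G hG => by
      obtain ⟨_, hc, ht, hd, S, g, r, g₀, s, ι, e, v₀, v₁, n₀, ε, hne, hprime, hι, hg₀, hs, hsr, hst₀, hst₁, hC,
        hV, hN, hε, hV₀, hV₁, hE, -, -, hends⟩ := hΩ G hG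
      haveI := hc
      haveI := ht
      haveI := hd
      exact G.branchLink_of_twoComponentPointed hne hprime ι hι hg₀ hs hsr hst₀ hst₁
        (by unfold PuncturedSurfaceGroup.IsHyperbolicType; omega) e hC v₀ v₁ hV ε hε hV₀ hV₁ n₀ hN hE hends
  have hchar : CuspidalEdgeLikeCharacterizationHolds Ω :=
    cuspidalEdgeLikeCharacterizationHolds_of_cuspidallyStandard Ω fun Q _ _ _ G hG => by
      obtain ⟨hc, ht, hd, S, g, r, g₀, s, ι, e, v₀, v₁, n₀, ε, hne, hprime, hι, hg₀, hs, hsr, hst₀, hst₁, hC,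
        -⟩ := hΩ₂ G hG
      exact ⟨hc, ht, hd, S, g, r, ι, e, hne, hprime,
        by unfold PuncturedSurfaceGroup.IsHyperbolicType; omega, hι, hC⟩
  exact ⟨h12i, h15i, h15ii, twoComponentPointedOrigin_commensurableTerminalityHolds Ω hΩ₂, hchar,
    fun l hSig => numericallyCuspidalIffHolds_of_twoComponentAffine' Ω l hΩ₂ hSig⟩

/-- **At the origin of ALL two-component one-node data with both components marked and `Σ = {l}`** —
inhabited for EVERY `g₀ ≤ g`, `1 ≤ s ≤ r − 1` with `1 ≤ g₀ ∨ 2 ≤ r − s` and `1 ≤ g − g₀ ∨ 2 ≤ s` (so a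
component with a SINGLE marked point, of genus `≥ 1`, is allowed) — F-0438 (Prop. 1.2 (ii), both clauses),
F-0459 (Prop. 1.2 (i)), F-0440 (Prop. 1.5 (i)), F-0443 (Prop. 1.5 (ii)), F-1931 ([IUTchI] Rmk. 1.2.3 (iv),
cuspidal) and F-0458 (Thm. 1.6 (i)) ALL HOLD. [cite: MochizukiCombGC2007, Prop 1.5(ii) p.13]
[cite: MochizukiCombGC2007, Prop 1.2 pp.8-9] [cite: MochizukiCombGC2007, Thm 1.6(i) p.13] -/
theorem exists_twoComponentPointedOrigin_holds_all (l : ℕ) (hl : l.Prime) :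
    ∃ Ω : PSCOrigin.{0},
      (∀ g r g₀ s : ℕ, g₀ ≤ g → 1 ≤ s → s + 1 ≤ r → (1 ≤ g₀ ∨ 2 ≤ r - s) → (1 ≤ g - g₀ ∨ 2 ≤ s) →
        ∃ (Q : ProfiniteGrp.{0}) (ι : PuncturedSurfaceGroup g r →* Q) (G : PSCDatum Q),
          IsProSigmaCompletion {l} ι ∧ Ω.IsOfPSCType G ∧ G.Sigma = {l} ∧ G.graph.i = 2 ∧ G.graph.n = 1 ∧
            G.graph.r = r ∧ (∃ v₀ v₁ : G.graph.V, (∀ w, w = v₀ ∨ w = v₁) ∧ G.genus v₀ = g₀ ∧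
              G.genus v₁ = g - g₀)) ∧
      CommensurableTerminalityHolds Ω ∧ OpenInterDeterminesComponentHolds Ω ∧ EdgeLikeIncidenceHolds Ω ∧
      GraphicIffEdgeLikeVerticialHolds Ω ∧ CuspidalEdgeLikeCharacterizationHolds Ω ∧
      NumericallyCuspidalIffHolds Ω := by
  classical
  let Ω : PSCOrigin.{0} :=
    ⟨fun {Q} _ _ G => G.Sigma = {l} ∧ ∃ (_ : IsTopologicalGroup Q), CompactSpace Q ∧ T2Space Q ∧
      TotallyDisconnectedSpace Q ∧
      ∃ (S : Set ℕ) (g r g₀ s : ℕ) (ι : PuncturedSurfaceGroup g r →* Q) (e : G.graph.C ≃ Fin r)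
        (v₀ v₁ : G.graph.V) (n₀ : G.graph.N) (ε : PuncturedSurfaceGroup g r),
        S.Nonempty ∧ (∀ p ∈ S, p.Prime) ∧ IsProSigmaCompletion S ι ∧ g₀ ≤ g ∧ 1 ≤ s ∧ s + 1 ≤ r ∧
        (1 ≤ g₀ ∨ 2 ≤ r - s) ∧ (1 ≤ g - g₀ ∨ 2 ≤ s) ∧
        (∀ c, G.cuspGp c =
          ((PuncturedSurfaceGroup.cuspInertia (g := g) (e c)).map ι).topologicalClosure) ∧
        (∀ w, w = v₀ ∨ w = v₁) ∧ (∀ n, n = n₀) ∧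
        ε = ((List.finRange r).map fun j : Fin r =>
          if s ≤ (j : ℕ) then PuncturedSurfaceGroup.c (g := g) j else 1).prod *
        ((List.finRange g).map fun i : Fin g => if (i : ℕ) < g₀ then
          PuncturedSurfaceGroup.a (r := r) i * PuncturedSurfaceGroup.b i *
            (PuncturedSurfaceGroup.a i)⁻¹ * (PuncturedSurfaceGroup.b i)⁻¹ else 1).prod ∧
        G.vertGp v₀ = ((Subgroup.closure {x : PuncturedSurfaceGroup g r |
          (∃ i : Fin g, (i : ℕ) < g₀ ∧ (x = PuncturedSurfaceGroup.a i ∨ x = PuncturedSurfaceGroup.b i)) ∨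
          ∃ j : Fin r, s ≤ (j : ℕ) ∧ x = PuncturedSurfaceGroup.c j}).map ι).topologicalClosure ∧
        G.vertGp v₁ = ((Subgroup.closure {x : PuncturedSurfaceGroup g r |
          (∃ i : Fin g, g₀ ≤ (i : ℕ) ∧ (x = PuncturedSurfaceGroup.a i ∨ x = PuncturedSurfaceGroup.b i)) ∨
          (∃ j : Fin r, (j : ℕ) < s ∧ x = PuncturedSurfaceGroup.c j) ∨ x = ε}).map ι).topologicalClosure ∧
        G.nodeGp n₀ = ((Subgroup.zpowers ε).map ι).topologicalClosure ∧
        G.genus v₀ = g₀ ∧ G.genus v₁ = g - g₀ ∧ (∀ n, G.graph.nodeEnds n = s(v₀, v₁))⟩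
  have hl' : ∀ p ∈ ({l} : Set ℕ), p.Prime := fun p hp => by
    rw [Set.mem_singleton_iff.mp hp]; exact hl
  obtain ⟨h12i, h15i, h15ii, h12ii, hchar, h16i⟩ := twoComponentPointedOrigin_allRows Ω (fun Q _ _ G hG => hG.2)
  refine ⟨Ω, fun g r g₀ s hg₀ hs hsr hst₀ hst₁ => ?_, h12ii, h12i, h15i, h15ii, hchar,
    h16i l (fun Q _ _ _ G hG => hG.1)⟩
  obtain ⟨Q, ι, G, e, v₀, v₁, n₀, ε, hι, hS, hi, hn, hr, hC, hV, hN, hε, hV₀, hV₁, hE, hgen₀, hgen₁, hends, -⟩ :=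
    exists_twoComponentAffineDatum {l} ⟨l, rfl⟩ hl' g r g₀ s
  exact ⟨Q, ι, G, hι, ⟨hS, inferInstance, inferInstance, inferInstance, inferInstance, {l}, g, r, g₀, s, ι, e,
    v₀, v₁, n₀, ε, ⟨l, rfl⟩, hl', hι, hg₀, hs, hsr, hst₀, hst₁, hC, hV, hN, hε, hV₀, hV₁, hE, hgen₀, hgen₁,
    hends⟩, hS, hi, hn, hr, ⟨v₀, v₁, hV, hgen₀, hgen₁⟩⟩

end PSCDatum

end Literature.AnabelianGeometry.SemiGraphs

end
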